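import Literature.Probability.Percolation.ArmSeparationLanes
import HarnessLib

/-!
# The cut of the lane routing for the adjacent colour arrangement (with a rotation of the targets)

Topic `Literature/Probability/Percolation`; family `crit-perc` / near-critical percolation on `𝕋`.
A brick of the near-critical arm-separation theorem for four arms in the ADJACENT colour
arrangement (P. Nolin, EJP 13 (2008), Thm. 11, `j = 4`, `σ = BBWW` [arXiv 0711.4948: Thm. 10];
the input `hsepAdj` of `Werner2009_lemma63_of_altSeparation_of_adjSeparation`), landing step.

The four fenced tips sit on the perimeter `ℤ/12M` of `∂Λ_{2M}` in the cyclic order open, open,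
closed, closed (keys `τ 0, τ 1, τ 2, τ 3`); the four target boxes on the sides `0, 2` (open) and
`3, 5` (closed) of `∂Λ_{4M}` have keys `γ 0, γ 1, γ 2, γ 3` in the same cyclic order, the gap from
`γ 0` to `γ 1` (side `0` to side `2`) being longer than one side (`≥ 2M + 6s`). Unlike the alternating
arrangement (`Lanes.exists_cut`, `ArmSeparationLanes.lean`: cut next to a closed tip, parities), the
only colour-preserving matching of tips to targets is the identity, and for FIXED targets a cut
separating tips and targets compatibly need not exist; it always exists after ROTATING the
configuration by a multiple of `60°` (`r < 6`, keys shifted by `-2Mr`): cut just after the open tip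
`0` (inside the open block), and choose `r` so that the shifted cut falls in the long target gap —
the six translates of that gap cover the circle.

* `shd M d x` — the shift `x ↦ x - d` of `ℤ/12M` on representatives; `cyc_shd` (invariance of `cyc`);
* `rotKey M i ζ = 2Mi + ζ + 2M` — the perimeter key of the row `ζ ∈ [-2M, 0)` of side `i` read through
  the rotation `ρ^i`; `rotKey_range`, `rotKey_rot` (rotating the frame index shifts the key);
* `cyc_lin` — linear form of "cyclically increasing from the first point";
* `adj_cut_tips` — read from the cut `3s` after the tip `0`, the tips come in the order `1, 2, 3, 0`,
  all at least `3s` away;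
* `adj_cut_targets` — a rotation `r < 6` putting the shifted cut in the long target gap, the targets
  then read `1, 2, 3, 0`, all at least `3s` away;
* `adj_exists_cut` — **the cut**: `r < 6` and `c ∈ [0, 12M)` with the shifted tips and the targets
  both read increasingly `1, 2, 3, 0` from `c`, all `≥ 3s` from it.

Everything here is proved; no named facts are introduced.

## References

* P. Nolin, Near-critical percolation in two dimensions, *Electron. J. Probab.* 13 (2008), §4.3
  Prop. 12 (i) and §4.4 p. 12 (arXiv 0711.4948: Prop. 11; relocation of the landing areas) [Nolin2008].
-/

noncomputable section

namespace Literature.Probability.Percolation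

namespace Lanes

/-! ### Shifts of the perimeter -/

/-- **Shift by `-d`** on representatives of `ℤ/12M` in `[0, 12M)`. [folklore] -/
def shd (M : ℕ) (d x : ℤ) : ℤ := if d ≤ x then x - d else x - d + 12 * M

/-- The shift stays in `[0, 12M)`. [folklore] -/
theorem shd_range {M : ℕ} {d x : ℤ} (_hd : 0 ≤ d ∧ d < 12 * M) (hx : 0 ≤ x ∧ x < 12 * M) :
    0 ≤ shd M d x ∧ shd M d x < 12 * M := by
  unfold shd; split_ifs <;> omega

/-- **`cyc` is invariant under shifts.** [folklore] -/
theorem cyc_shd {M : ℕ} {d x y : ℤ} (_hd : 0 ≤ d ∧ d < 12 * M) (hx : 0 ≤ x ∧ x < 12 * M) (hy : 0 ≤ y ∧ y < 12 * M) :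
    cyc (12 * M) (shd M d y) (shd M d x) = cyc (12 * M) y x := by
  unfold cyc shd; split_ifs <;> omega

/-! ### Keys of rotation readings -/

/-- **The perimeter key** of the row `ζ` of the side `i` read through `ρ^i` (anticlockwise position,
side `i` occupying `[2Mi, 2M(i+1))`). [folklore] -/
def rotKey (M i : ℕ) (ζ : ℤ) : ℤ := 2 * (M : ℤ) * i + (ζ + 2 * M)

/-- Keys lie in `[0, 12M)`. [folklore] -/
theorem rotKey_range {M i : ℕ} (hi : i < 6) {ζ : ℤ} (hζ : -(2 * (M : ℤ)) ≤ ζ ∧ ζ < 0) :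
    0 ≤ rotKey M i ζ ∧ rotKey M i ζ < 12 * M := by
  unfold rotKey; interval_cases i <;> push_cast <;> omega

/-- Keys of one side, compared. [folklore] -/
theorem rotKey_lt_rotKey_iff {M i : ℕ} {ζ ζ' : ℤ} : rotKey M i ζ < rotKey M i ζ' ↔ ζ < ζ' := by
  unfold rotKey; omega

/-- **Rotating the configuration by `r` shifts the keys by `-2Mr`**: the side `i` becomes the side
`(i + 6 - r) % 6`, the row is unchanged. [folklore] -/
theorem rotKey_rot {M i r : ℕ} (hi : i < 6) (hr : r < 6) {ζ : ℤ} (hζ : -(2 * (M : ℤ)) ≤ ζ ∧ ζ < 0) :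
    rotKey M ((i + 6 - r) % 6) ζ = shd M (2 * M * r) (rotKey M i ζ) := by
  unfold rotKey shd
  interval_cases i <;> interval_cases r <;> simp <;> (try split_ifs) <;> omega

/-! ### Linear form of a cyclic order -/

/-- **Four points cyclically increasing from the first**, in linear form: one of the four rotations
of the increasing chain. [folklore] -/
theorem cyc_lin {P : ℤ} {x₀ x₁ x₂ x₃ : ℤ} (_h0 : 0 ≤ x₀ ∧ x₀ < P) (h1 : 0 ≤ x₁ ∧ x₁ < P) (h2 : 0 ≤ x₂ ∧ x₂ < P) (h3 : 0 ≤ x₃ ∧ x₃ < P)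
    (hcyc : cyc P x₀ x₁ < cyc P x₀ x₂ ∧ cyc P x₀ x₂ < cyc P x₀ x₃) (h01 : 0 < cyc P x₀ x₁) :
    (x₀ < x₁ ∧ x₁ < x₂ ∧ x₂ < x₃) ∨ (x₁ < x₂ ∧ x₂ < x₃ ∧ x₃ < x₀) ∨ (x₂ < x₃ ∧ x₃ < x₀ ∧ x₀ < x₁) ∨
      (x₃ < x₀ ∧ x₀ < x₁ ∧ x₁ < x₂) := by
  obtain ⟨ha, hb⟩ := hcyc
  unfold cyc at ha hb h01; split_ifs at ha hb h01 <;> omega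

/-- `cyc`, linearised. [folklore] -/
theorem cyc_eq_ite (P y x : ℤ) : cyc P y x = if y ≤ x then x - y else x - y + P := rfl

/-! ### The cut after the first open tip -/

/-- **Tips read from the cut `c₀ = τ 0 + 3s`** (tips in `[0, 12M)` cyclically increasing from `τ 0`,
the gap from `τ 0` to `τ 1` at least `6s`, `1 ≤ s`, `3s < 12M`): from `c₀` the tips read `1, 2, 3, 0`
and all are at least `3s` away. [folklore] -/
theorem adj_cut_tips {M s : ℕ} (hs : 1 ≤ s) {τ : Fin 4 → ℤ} (hτ : ∀ a, 0 ≤ τ a ∧ τ a < 12 * M)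
    (hcyc : cyc (12 * M) (τ 0) (τ 1) < cyc (12 * M) (τ 0) (τ 2) ∧ cyc (12 * M) (τ 0) (τ 2) < cyc (12 * M) (τ 0) (τ 3))
    (h01 : 0 < cyc (12 * M) (τ 0) (τ 1)) (hg : 6 * (s : ℤ) ≤ cyc (12 * M) (τ 0) (τ 1)) (hP : 6 * (s : ℤ) ≤ 12 * M)
    {c₀ : ℤ} (hc₀ : c₀ = if τ 0 + 3 * s < 12 * M then τ 0 + 3 * s else τ 0 + 3 * s - 12 * M) :
    (cyc (12 * M) c₀ (τ 1) < cyc (12 * M) c₀ (τ 2) ∧ cyc (12 * M) c₀ (τ 2) < cyc (12 * M) c₀ (τ 3) ∧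
      cyc (12 * M) c₀ (τ 3) < cyc (12 * M) c₀ (τ 0)) ∧
    (3 * (s : ℤ) ≤ cyc (12 * M) c₀ (τ 0) ∧ 3 * (s : ℤ) ≤ cyc (12 * M) c₀ (τ 1) ∧ 3 * (s : ℤ) ≤ cyc (12 * M) c₀ (τ 2) ∧
      3 * (s : ℤ) ≤ cyc (12 * M) c₀ (τ 3)) := by
  have hτ0 := hτ 0; have hτ1 := hτ 1; have hτ2 := hτ 2; have hτ3 := hτ 3
  have hlin := cyc_lin hτ0 hτ1 hτ2 hτ3 hcyc h01
  have hg' : (τ 0 ≤ τ 1 → 6 * (s : ℤ) ≤ τ 1 - τ 0) ∧ (τ 1 < τ 0 → 6 * (s : ℤ) ≤ τ 1 - τ 0 + 12 * M) := by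
    rw [cyc_eq_ite] at hg; split_ifs at hg <;> constructor <;> intros <;> omega
  clear hcyc h01 hg hτ
  have hc : (τ 0 + 3 * s < 12 * M ∧ c₀ = τ 0 + 3 * s) ∨ (12 * (M : ℤ) ≤ τ 0 + 3 * s ∧ c₀ = τ 0 + 3 * s - 12 * M) := by
    rw [hc₀]; split_ifs with h
    · exact Or.inl ⟨h, rfl⟩
    · exact Or.inr ⟨not_lt.1 h, rfl⟩
  clear hc₀
  simp only [cyc_eq_ite]
  refine ⟨⟨?_, ?_, ?_⟩, ?_, ?_, ?_, ?_⟩ <;> rcases hc with hc | hc <;> rcases hlin with h | h | h | h <;>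
    split_ifs <;> omega

/-- **Targets and the rotation.** Targets `v e ∈ [0, 12M)` cyclically increasing from `v 0`, the gap
from `v 0` to `v 1` at least `2M + 6s` (`1 ≤ M`, `1 ≤ s`, `6s + 2M ≤ 12M`); a point `κ ∈ [0, 12M)`. Then some
rotation `r < 6` puts the shifted point `c = shd (2Mr) κ` in the long gap: the targets read `1, 2, 3, 0`
from `c`, all at least `3s` away. [folklore] -/
theorem adj_cut_targets {M s : ℕ} (hM : 1 ≤ M) (hs : 1 ≤ s) {v : Fin 4 → ℤ} (hv : ∀ e, 0 ≤ v e ∧ v e < 12 * M)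
    (hcyc : cyc (12 * M) (v 0) (v 1) < cyc (12 * M) (v 0) (v 2) ∧ cyc (12 * M) (v 0) (v 2) < cyc (12 * M) (v 0) (v 3))
    (hG : 2 * (M : ℤ) + 6 * s ≤ cyc (12 * M) (v 0) (v 1)) (hsM : 6 * (s : ℤ) + 2 * M ≤ 12 * M)
    {κ : ℤ} (hκ : 0 ≤ κ ∧ κ < 12 * M) :
    ∃ r : ℕ, r < 6 ∧
      (cyc (12 * M) (shd M (2 * M * r) κ) (v 1) < cyc (12 * M) (shd M (2 * M * r) κ) (v 2) ∧
        cyc (12 * M) (shd M (2 * M * r) κ) (v 2) < cyc (12 * M) (shd M (2 * M * r) κ) (v 3) ∧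
        cyc (12 * M) (shd M (2 * M * r) κ) (v 3) < cyc (12 * M) (shd M (2 * M * r) κ) (v 0)) ∧
      (3 * (s : ℤ) ≤ cyc (12 * M) (shd M (2 * M * r) κ) (v 0) ∧ 3 * (s : ℤ) ≤ cyc (12 * M) (shd M (2 * M * r) κ) (v 1) ∧
        3 * (s : ℤ) ≤ cyc (12 * M) (shd M (2 * M * r) κ) (v 2) ∧ 3 * (s : ℤ) ≤ cyc (12 * M) (shd M (2 * M * r) κ) (v 3)) := by
  have hv0 := hv 0; have hv1 := hv 1; have hv2 := hv 2; have hv3 := hv 3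
  have h01 : 0 < cyc (12 * M) (v 0) (v 1) := by omega
  have hlin := cyc_lin hv0 hv1 hv2 hv3 hcyc h01
  have hG' : (v 0 ≤ v 1 → 2 * (M : ℤ) + 6 * s ≤ v 1 - v 0) ∧ (v 1 < v 0 → 2 * (M : ℤ) + 6 * s ≤ v 1 - v 0 + 12 * M) := by
    rw [cyc_eq_ite] at hG; split_ifs at hG <;> constructor <;> intros <;> omega
  clear hcyc hG hv
  -- the start of the gap with its margin, and the offset of `κ` from it
  obtain ⟨g₀, hg₀⟩ : ∃ g₀ : ℤ, g₀ = if v 0 + 3 * s < 12 * M then v 0 + 3 * s else v 0 + 3 * s - 12 * M := ⟨_, rfl⟩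
  have hg₀r : 0 ≤ g₀ ∧ g₀ < 12 * M := by rw [hg₀]; split_ifs <;> omega
  obtain ⟨δ, hδ⟩ : ∃ δ : ℤ, δ = cyc (12 * M) g₀ κ := ⟨_, rfl⟩
  have hδr : 0 ≤ δ ∧ δ < 12 * M := by rw [hδ]; exact cyc_range hg₀r.1 hg₀r.2 hκ.1 hκ.2
  -- the position of `κ`: `κ ≡ v 0 + 3s + δ`
  have hκrep : κ = v 0 + 3 * s + δ ∨ κ = v 0 + 3 * s + δ - 12 * M ∨ κ = v 0 + 3 * s + δ - 24 * M := by
    rw [hδ, cyc_eq_ite, hg₀]; split_ifs <;> omega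
  clear hδ hg₀ hg₀r g₀
  -- the rotation: `2Mr ≤ δ < 2M(r+1)`
  have h2M : (0 : ℤ) < 2 * M := by omega
  obtain ⟨q, hq⟩ : ∃ q : ℤ, q = δ / (2 * M) := ⟨_, rfl⟩
  have hq0 : 0 ≤ q := by rw [hq]; exact Int.ediv_nonneg hδr.1 h2M.le
  have hqδ : 2 * (M : ℤ) * q ≤ δ := by rw [hq]; exact Int.mul_ediv_self_le (by omega)
  have hδq : δ < 2 * (M : ℤ) * q + 2 * M := by rw [hq]; exact Int.lt_mul_ediv_self_add h2M
  have hq6 : q < 6 := by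
    by_contra h
    push Not at h
    have : 2 * (M : ℤ) * 6 ≤ 2 * (M : ℤ) * q := mul_le_mul_of_nonneg_left h (by omega)
    omega
  obtain ⟨r, hr⟩ : ∃ r : ℕ, (r : ℤ) = q := ⟨q.toNat, Int.toNat_of_nonneg hq0⟩
  have hr6 : r < 6 := by omega
  refine ⟨r, hr6, ?_⟩
  -- `d = 2Mr`: `d ≤ δ < d + 2M`, `0 ≤ d`, `d + 2M ≤ 12M`
  obtain ⟨d, hd⟩ : ∃ d : ℤ, d = 2 * M * r := ⟨_, rfl⟩
  have hdδ : d ≤ δ ∧ δ < d + 2 * M := by rw [hd, hr]; exact ⟨hqδ, hδq⟩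
  have hd0 : 0 ≤ d ∧ d + 2 * M ≤ 12 * M := by rw [hd]; clear hdδ hd; interval_cases r <;> push_cast <;> omega
  rw [← hd]
  clear hq hq0 hqδ hδq hq6 hr hr6 hd q
  -- the shifted cut: `c ≡ κ - d ≡ v 0 + 3s + (δ - d)`
  have hcrep : shd M d κ = v 0 + 3 * s + (δ - d) ∨ shd M d κ = v 0 + 3 * s + (δ - d) - 12 * M := by
    unfold shd; split_ifs <;> omega
  have hcr : 0 ≤ shd M d κ ∧ shd M d κ < 12 * M := shd_range ⟨hd0.1, by omega⟩ hκ
  generalize shd M d κ = c at hcrep hcr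
  clear hκrep hκ
  simp only [cyc_eq_ite]
  refine ⟨⟨?_, ?_, ?_⟩, ?_, ?_, ?_, ?_⟩ <;> rcases hcrep with hc | hc <;> rcases hlin with h | h | h | h <;>
    split_ifs <;> omega

/-- **The cut.** Tips `τ a ∈ [0, 12M)` cyclically increasing from `τ 0` with the gap from `τ 0` to
`τ 1` at least `6s` (`1 ≤ s`); targets `γ e ∈ [0, 12M)` cyclically increasing from `γ 0` with the gap
from `γ 0` to `γ 1` at least `2M + 6s`; `6s + 2M ≤ 12M`. Then for some rotation `r < 6` and some cut
`c ∈ [0, 12M)`: the shifted tips `shd (2Mr) (τ a)` read `1, 2, 3, 0` from `c`, the targets read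
`1, 2, 3, 0` from `c`, and all eight are at least `3s` away from `c`. [cite: Nolin2008, §4.3 Prop. 12 (i) and §4.4 p. 12 (arXiv 0711.4948: Prop. 11; relocation of the landing areas)] -/
theorem adj_exists_cut {M s : ℕ} (hM : 1 ≤ M) (hs : 1 ≤ s) {τ γ : Fin 4 → ℤ}
    (hτ : ∀ a, 0 ≤ τ a ∧ τ a < 12 * M) (hγ : ∀ e, 0 ≤ γ e ∧ γ e < 12 * M)
    (hτcyc : cyc (12 * M) (τ 0) (τ 1) < cyc (12 * M) (τ 0) (τ 2) ∧ cyc (12 * M) (τ 0) (τ 2) < cyc (12 * M) (τ 0) (τ 3))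
    (hγcyc : cyc (12 * M) (γ 0) (γ 1) < cyc (12 * M) (γ 0) (γ 2) ∧ cyc (12 * M) (γ 0) (γ 2) < cyc (12 * M) (γ 0) (γ 3))
    (hgτ : 6 * (s : ℤ) ≤ cyc (12 * M) (τ 0) (τ 1))
    (hgγ : 2 * (M : ℤ) + 6 * s ≤ cyc (12 * M) (γ 0) (γ 1)) (hsM : 6 * (s : ℤ) + 2 * M ≤ 12 * M) :
    ∃ r : ℕ, r < 6 ∧ ∃ c : ℤ, 0 ≤ c ∧ c < 12 * M ∧
      (cyc (12 * M) c (shd M (2 * M * r) (τ 1)) < cyc (12 * M) c (shd M (2 * M * r) (τ 2)) ∧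
        cyc (12 * M) c (shd M (2 * M * r) (τ 2)) < cyc (12 * M) c (shd M (2 * M * r) (τ 3)) ∧
        cyc (12 * M) c (shd M (2 * M * r) (τ 3)) < cyc (12 * M) c (shd M (2 * M * r) (τ 0))) ∧
      (∀ a, 3 * (s : ℤ) ≤ cyc (12 * M) c (shd M (2 * M * r) (τ a))) ∧
      (cyc (12 * M) c (γ 1) < cyc (12 * M) c (γ 2) ∧ cyc (12 * M) c (γ 2) < cyc (12 * M) c (γ 3) ∧
        cyc (12 * M) c (γ 3) < cyc (12 * M) c (γ 0)) ∧
      (∀ e, 3 * (s : ℤ) ≤ cyc (12 * M) c (γ e)) := by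
  have hτ0 := hτ 0
  -- the cut in the original coordinates
  obtain ⟨c₀, hc₀⟩ : ∃ c₀ : ℤ, c₀ = if τ 0 + 3 * s < 12 * M then τ 0 + 3 * s else τ 0 + 3 * s - 12 * M := ⟨_, rfl⟩
  have hc₀r : 0 ≤ c₀ ∧ c₀ < 12 * M := by rw [hc₀]; split_ifs <;> omega
  obtain ⟨hordτ, f0, f1, f2, f3⟩ := adj_cut_tips hs hτ hτcyc (by omega) hgτ (by omega) hc₀
  -- the rotation
  obtain ⟨r, hr6, hordγ, g0, g1, g2, g3⟩ := adj_cut_targets hM hs hγ hγcyc hgγ hsM hc₀r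
  have hd0 : 0 ≤ (2 * M * r : ℤ) ∧ (2 * M * r : ℤ) < 12 * M := by interval_cases r <;> push_cast <;> omega
  refine ⟨r, hr6, shd M (2 * M * r) c₀, (shd_range hd0 hc₀r).1, (shd_range hd0 hc₀r).2, ?_, fun a => ?_, hordγ, fun e => ?_⟩
  · rw [cyc_shd hd0 (hτ 1) hc₀r, cyc_shd hd0 (hτ 2) hc₀r, cyc_shd hd0 (hτ 3) hc₀r, cyc_shd hd0 (hτ 0) hc₀r]
    exact hordτ
  · rw [cyc_shd hd0 (hτ a) hc₀r]
    fin_cases a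
    · exact f0
    · exact f1
    · exact f2
    · exact f3
  · fin_cases e
    · exact g0
    · exact g1
    · exact g2
    · exact g3

end Lanes

end Literature.Probability.Percolation
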